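import Summits.QuantumAdvantage.QuantumAdvantage.Theorems.WalkTwoStepLocalEngineGlue
import Summits.QuantumAdvantage.QuantumAdvantage.Theorems.WalkFiniteStateRung

/-!
# (G♯) local engine — `SparsePinned p` PROVED, part 1/3: §A two-step forms and fibre statuses as functions of the window residue; the twisted three-charge lemma `not_winE_all_three`

# (G♯) local engine — the sparse pinned branch `SparsePinned p` PROVED (every prime `p ≥ 5`)

Cell qa-qnc0, rung (G♯) = item stmt-QuantumAdvantage-23121 `OddPrimeWalk.TwoStepFreeRungFive` (planner qa-qnc0-p2 g24, ask P2-24b,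
ROUND-24 §1ter REVISION (h) audit "TRUE as typed"); prover qn-prover-3 g15.  One of the three OPEN regime lemmas of the checked skeleton
`WalkTwoStepLocalEngine{Core,Regimes,Glue}.lean` (`twoStepFreeRungFive_of : FarLocal 5 → SparsePinned 5 → DensePinned 5 → …`).

STATEMENT (`LocalEngine.SparsePinned p`, verbatim from the skeleton): for every `ε > 0` there is a window length `m` such that for every
two-step free-split strategy `S`, class `w`, pin datum `(d₀, u₀)` and charge `c`, if `(2·effOn + #pinTimes + 2p + 1)·m ≤ n` then the part
`Q = part S d₀ w u₀` satisfies `#winPart ≤ (2/3 + ε)·#Q`.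

PROOF (port of rung (G)'s window branch `RungG.stub_sparse` / `fibre_bound`, with two additions).
* §A two-step forms on a glued input `uA ++ v ++ uB` (`CleanGapStrategies.glue3`): a cut whose position and split both avoid the OPEN
  window has fire bit / live bit / status equal to explicit functions `fireR / liveR / statusR` of the window residue `r = wt v (mod 3p)`
  (`RungG.liftOf`, `RungG.stateOf`); passing to the lift `r + j·p` keeps `fireR` and twists the phase by `p` (cuts `≤ a`) or `2p`
  (cuts `> a`), so by `Coset21.twistedNotAllThree` the three lifts of a residue mod `p` do NOT all win (`not_winE_all_three`).
* §B the part on a fibre: with the window inside `[p, n − p)` and no pin time strictly inside it, membership of `uA ++ v ++ uB` in `Q`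
  depends on `v` only through `wt v (mod p)` (`mem_part_glue3_of_wt_eq`), so the fibre of `Q` is empty or a full residue class mod `p`.
* §C (new) cuts that are NOT effective on `Q` have status identically `false` on `Q`: a second, `g`-free window and the three lifts
  rotate the phase of `g` through all of `ℤ₃` inside `Q` (`exists_status_false`), so a constant status is the constant `false`.  (Without
  this the parity argument would only bound the effective cuts' contribution up to an unknown constant.)
* §D pigeonhole for a free window among `2·effOn + #pinTimes + 1` candidates inside `[p, n − p)`, the per-fibre bound (the arithmetic of
  `RungG.fibre_bound` verbatim, `RungG.stub_equidist` at modulus `3p`), Fubini `card_filter_eq_sum_glue3`; `sparsePinned_of_prime`,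
  `sparsePinned_five : SparsePinned 5`.

WHAT THIS IS NOT: `FarLocal` and `DensePinned` stay open (so (G♯) is not yet proved); nothing about `LinSel`/R5; separation NOT moved.

This file: §A only.  Parts 2/3 and 3/3: `WalkTwoStepSparsePinnedPart.lean`, `WalkTwoStepSparsePinned.lean`.
-/

namespace Summit.QuantumAdvantage.AdviceFreeQNC0.LocalEngine
open Finset Classical
open Summit.QuantumAdvantage.AdviceFreeQNC0.Coset21 (twistedNotAllThree)
open Summit.QuantumAdvantage.AdviceFreeQNC0.Coset21.RungG (classOf proj proj_natCast liftOf stateOf liftOf_glue3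
  stateOf_glue3 cast3_val_add_nat exists_lift_eq proj_lift Equidist stub_equidist mod_three_of_mod)

/-! ### §A Two-step forms, and statuses on a glued fibre as functions of the window residue -/

section Forms

variable {p n : ℕ}

/-- `|u| = #{i < s : u_i} + #{i ≥ s : u_i}`. -/
theorem wt_eq_wtPrefix_add_card (u : Fin n → Bool) (s : ℕ) :
    wt u = wtPrefix u s + (univ.filter fun i : Fin n => s ≤ i.val ∧ u i = true).card := by
  unfold wt wtPrefix
  rw [← Finset.card_union_of_disjoint]
  · congr 1
    ext i
    simp only [Finset.mem_filter, Finset.mem_union, Finset.mem_univ, true_and]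
    constructor
    · intro h
      by_cases hi : i.val < s
      · exact Or.inl ⟨hi, h⟩
      · exact Or.inr ⟨by omega, h⟩
    · rintro (h | h)
      · exact h.2
      · exact h.2
  · rw [Finset.disjoint_filter]
    intro i _ h1 h2
    omega

/-- The two-step free-split form evaluates to `α·N(s) + β·(W − N(s))`. -/
theorem twoStepForm_eq (u : Fin n → Bool) (s : ℕ) (α β : ZMod p) :
    (∑ i : Fin n, if u i = true then (if i.val < s then α else β) else 0)
      = α * ((wtPrefix u s : ℕ) : ZMod p) + β * (((wt u : ℕ) : ZMod p) - ((wtPrefix u s : ℕ) : ZMod p)) := by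
  have h1 : (∑ i : Fin n, if u i = true then (if i.val < s then α else β) else 0)
      = ∑ i : Fin n, ((if (i.val < s ∧ u i = true) then α else 0) + (if (s ≤ i.val ∧ u i = true) then β else 0)) := by
    refine Finset.sum_congr rfl fun i _ => ?_
    by_cases hu : u i = true
    · by_cases hi : i.val < s
      · have hi' : ¬ s ≤ i.val := by omega
        simp [hu, hi, hi']
      · have hi' : s ≤ i.val := by omega
        simp [hu, hi, hi']
    · simp [hu]
  have h2 : ((wt u : ℕ) : ZMod p) - ((wtPrefix u s : ℕ) : ZMod p)
      = (((univ.filter fun i : Fin n => s ≤ i.val ∧ u i = true).card : ℕ) : ZMod p) := by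
    rw [wt_eq_wtPrefix_add_card u s, Nat.cast_add]
    ring
  rw [h1, Finset.sum_add_distrib, h2]
  rw [← Finset.sum_filter, ← Finset.sum_filter, Finset.sum_const, Finset.sum_const, nsmul_eq_mul, nsmul_eq_mul]
  unfold wtPrefix
  ring

/-- Cut `g`'s test as a decision on `N(s_g)` and `W`. -/
theorem y_eq_decide (S : TwoStep p n) (g : Fin (n + 1)) (u : Fin n → Bool) :
    S.y g u = decide (S.α g * ((wtPrefix u (S.s g) : ℕ) : ZMod p)
      + S.β g * (((wt u : ℕ) : ZMod p) - ((wtPrefix u (S.s g) : ℕ) : ZMod p)) = S.r g) := by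
  unfold TwoStep.y
  rw [twoStepForm_eq]

/-- `status = true` iff the cut fires and is live (the predicate counted by `ringWinU`). -/
theorem status_eq_true_iff (c : ℕ) (S : TwoStep p n) (g : Fin (n + 1)) (u : Fin n → Bool) :
    status c S g u = true ↔ (S.y g u = true ∧ (c + g.val + walkExp u g.val) % 3 ≠ 0) := by
  unfold status
  rw [Bool.and_eq_true, decide_eq_true_iff]

/-- `ringWinU` counts the cuts with `status = true`. -/
theorem ringWinU_eq_true_iff_odd_status (c : ℕ) (S : TwoStep p n) (u : Fin n → Bool) :
    ringWinU c S.y u = true ↔ Odd ((univ.filter fun g : Fin (n + 1) => status c S g u = true).card) := by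
  unfold ringWinU
  rw [decide_eq_true_iff, ← Nat.odd_iff]
  have hset : (univ.filter fun g : Fin (n + 1) => S.y g u = true ∧ (c + g.val + walkExp u g.val) % 3 ≠ 0)
      = univ.filter fun g : Fin (n + 1) => status c S g u = true :=
    Finset.filter_congr fun g _ => (status_eq_true_iff c S g u).symm
  rw [hset]

end Forms

section Fibre

variable {p : ℕ} {M : ℕ} {a q : ℕ}

/-- Fire bit of cut `g` on the fibre `(uA, uB)`, as a function of the window residue `r` (mod `3p`). -/
noncomputable def fireR (hM : M + 1 = 3 * p) (m : ℕ) (S : TwoStep p (a + m + q)) (uA : Fin a → Bool) (uB : Fin q → Bool)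
    (g : Fin (a + m + q + 1)) (r : ZMod (M + 1)) : Bool :=
  decide (S.α g * proj hM (stateOf m uA uB r (S.s g))
    + S.β g * (proj hM (liftOf uA uB r) - proj hM (stateOf m uA uB r (S.s g))) = S.r g)

/-- Live bit of cut `g` on the fibre `(uA, uB)`, as a function of the window residue `r` (mod `3p`). -/
noncomputable def liveR (m c : ℕ) (uA : Fin a → Bool) (uB : Fin q → Bool)
    (g : Fin (a + m + q + 1)) (r : ZMod (M + 1)) : Bool :=
  decide ((c + g.val + (liftOf uA uB r).val + (stateOf m uA uB r g.val).val) % 3 ≠ 0)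

/-- Status (fires and live) of cut `g` on the fibre, as a function of the window residue. -/
noncomputable def statusR (hM : M + 1 = 3 * p) (m c : ℕ) (S : TwoStep p (a + m + q)) (uA : Fin a → Bool) (uB : Fin q → Bool)
    (g : Fin (a + m + q + 1)) (r : ZMod (M + 1)) : Bool :=
  fireR hM m S uA uB g r && liveR m c uA uB g r

/-- WIN on the fibre restricted to a set `E` of cuts, as a function of the window residue. -/
def WinE (hM : M + 1 = 3 * p) (m c : ℕ) (S : TwoStep p (a + m + q)) (E : Finset (Fin (a + m + q + 1)))
    (uA : Fin a → Bool) (uB : Fin q → Bool) (r : ZMod (M + 1)) : Prop :=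
  Odd ((E.filter fun g => statusR hM m c S uA uB g r = true).card)

/-- **Claim A**: for a cut whose position and split avoid the open window, the status on the glued input is `statusR` of the
window weight. -/
theorem status_glue3_eq_statusR (hM : M + 1 = 3 * p) {m : ℕ} (hm : 0 < m) (c : ℕ) (S : TwoStep p (a + m + q))
    (uA : Fin a → Bool) (v : Fin m → Bool) (uB : Fin q → Bool) (g : Fin (a + m + q + 1))
    (hg : g.val ≤ a ∨ a + m ≤ g.val) (hs : S.s g ≤ a ∨ a + m ≤ S.s g) :
    status c S g (glue3 uA v uB) = statusR hM m c S uA uB g ((wt v : ℕ) : ZMod (M + 1)) := by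
  have hL : liftOf uA uB ((wt v : ℕ) : ZMod (M + 1)) = ((wt (glue3 uA v uB) : ℕ) : ZMod (M + 1)) :=
    (liftOf_glue3 uA v uB).symm
  have hSg : stateOf m uA uB ((wt v : ℕ) : ZMod (M + 1)) g.val = ((wtPrefix (glue3 uA v uB) g.val : ℕ) : ZMod (M + 1)) :=
    (stateOf_glue3 hm uA v uB g.val hg).symm
  have hSs : stateOf m uA uB ((wt v : ℕ) : ZMod (M + 1)) (S.s g) = ((wtPrefix (glue3 uA v uB) (S.s g) : ℕ) : ZMod (M + 1)) :=
    (stateOf_glue3 hm uA v uB (S.s g) hs).symm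
  have hfire : fireR hM m S uA uB g ((wt v : ℕ) : ZMod (M + 1)) = S.y g (glue3 uA v uB) := by
    unfold fireR
    rw [hL, hSs, proj_natCast, proj_natCast, y_eq_decide]
  have hlive : liveR m c uA uB g ((wt v : ℕ) : ZMod (M + 1))
      = decide ((c + g.val + walkExp (glue3 uA v uB) g.val) % 3 ≠ 0) := by
    unfold liveR walkExp
    rw [hL, hSg, ZMod.val_natCast, ZMod.val_natCast, mod_three_of_mod hM]
  unfold status statusR
  rw [hfire, hlive]

/-- Lifting the residue by `j·p` shifts the lift by `j·p`. -/
theorem liftOf_add_natCast (uA : Fin a → Bool) (uB : Fin q → Bool) (r : ZMod (M + 1)) (k : ℕ) :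
    liftOf uA uB (r + (k : ZMod (M + 1))) = liftOf uA uB r + (k : ZMod (M + 1)) := by
  unfold liftOf; ring

/-- Lifting the residue does not move the states at cuts `≤ a`. -/
theorem stateOf_add_natCast_of_le {m : ℕ} (uA : Fin a → Bool) (uB : Fin q → Bool) (r : ZMod (M + 1)) (k : ℕ) {g : ℕ}
    (hg : g ≤ a) : stateOf m uA uB (r + (k : ZMod (M + 1))) g = stateOf m uA uB r g := by
  unfold stateOf; rw [if_pos hg, if_pos hg]

/-- Lifting the residue shifts the states at cuts `> a`. -/
theorem stateOf_add_natCast_of_gt {m : ℕ} (uA : Fin a → Bool) (uB : Fin q → Bool) (r : ZMod (M + 1)) (k : ℕ) {g : ℕ}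
    (hg : ¬ g ≤ a) : stateOf m uA uB (r + (k : ZMod (M + 1))) g = stateOf m uA uB r g + (k : ZMod (M + 1)) := by
  unfold stateOf; rw [if_neg hg, if_neg hg]; ring

/-- The projection to `ZMod p` kills multiples of `p`. -/
theorem proj_natCast_mul (hM : M + 1 = 3 * p) (j : ℕ) : proj hM (((j * p : ℕ) : ZMod (M + 1))) = 0 := by
  rw [proj_natCast, Nat.cast_mul, ZMod.natCast_self, mul_zero]

/-- The fire bit is invariant under the lifts `r ↦ r + j·p`. -/
theorem fireR_add_mul (hM : M + 1 = 3 * p) {m : ℕ} (S : TwoStep p (a + m + q)) (uA : Fin a → Bool) (uB : Fin q → Bool)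
    (g : Fin (a + m + q + 1)) (r : ZMod (M + 1)) (j : ℕ) :
    fireR hM m S uA uB g (r + ((j * p : ℕ) : ZMod (M + 1))) = fireR hM m S uA uB g r := by
  unfold fireR
  rw [liftOf_add_natCast, map_add, proj_natCast_mul hM j, add_zero]
  by_cases hs : S.s g ≤ a
  · rw [stateOf_add_natCast_of_le uA uB r _ hs]
  · rw [stateOf_add_natCast_of_gt uA uB r _ hs, map_add, proj_natCast_mul hM j, add_zero]

/-- **Claim B** (twisted three-charge): for any set of cuts `E`, the three lifts `r₀ + j·p` do not all win. -/
theorem not_winE_all_three [Fact p.Prime] (hM : M + 1 = 3 * p) (hp3 : ¬ 3 ∣ p) (m c : ℕ) (S : TwoStep p (a + m + q))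
    (E : Finset (Fin (a + m + q + 1))) (uA : Fin a → Bool) (uB : Fin q → Bool) (r₀ : ZMod (M + 1)) :
    ¬ (∀ j : ℕ, j < 3 → WinE hM m c S E uA uB (r₀ + ((j * p : ℕ) : ZMod (M + 1)))) := by
  -- fired set, labels and twists at `r₀`
  set F := E.filter fun g => fireR hM m S uA uB g r₀ = true with hF
  set s : Fin (a + m + q + 1) → ZMod 3 := fun g =>
    ((c + g.val + (liftOf uA uB r₀).val + (stateOf m uA uB r₀ g.val).val : ℕ) : ZMod 3) with hs
  set t : Fin (a + m + q + 1) → ZMod 3 := fun g => if g.val ≤ a then ((p : ℕ) : ZMod 3) else ((2 * p : ℕ) : ZMod 3) with ht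
  have hp0 : ((p : ℕ) : ZMod 3) ≠ 0 := by
    rw [Ne, ZMod.natCast_eq_zero_iff]; exact hp3
  have h2p0 : ((2 * p : ℕ) : ZMod 3) ≠ 0 := by
    rw [Ne, ZMod.natCast_eq_zero_iff]; omega
  have htne : ∀ g ∈ F, t g ≠ 0 := by
    intro g _; simp only [ht]; split_ifs; exacts [hp0, h2p0]
  have hmod : ∀ X : ℕ, (X % 3 ≠ 0) ↔ ((X : ZMod 3) ≠ 0) := fun X => by
    rw [Ne, Ne, ZMod.natCast_eq_zero_iff, Nat.dvd_iff_mod_eq_zero]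
  -- the set identity for each shift
  have hset : ∀ j : ℕ, (E.filter fun g => statusR hM m c S uA uB g (r₀ + ((j * p : ℕ) : ZMod (M + 1))) = true) =
      F.filter fun g => s g + ((j : ℕ) : ZMod 3) * t g ≠ 0 := by
    intro j
    rw [hF, Finset.filter_filter]
    refine Finset.filter_congr fun g _ => ?_
    simp only [statusR, Bool.and_eq_true, fireR_add_mul, liveR, decide_eq_true_eq, hs, ht]
    rw [liftOf_add_natCast]
    by_cases hg : g.val ≤ a
    · rw [stateOf_add_natCast_of_le uA uB r₀ _ hg, if_pos hg, hmod]
      have hlab : ((c + g.val + (liftOf uA uB r₀ + ((j * p : ℕ) : ZMod (M + 1))).val +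
            (stateOf m uA uB r₀ g.val).val : ℕ) : ZMod 3) =
          ((c + g.val + (liftOf uA uB r₀).val + (stateOf m uA uB r₀ g.val).val : ℕ) : ZMod 3) +
            ((j : ℕ) : ZMod 3) * ((p : ℕ) : ZMod 3) := by
        have e1 := cast3_val_add_nat hM (liftOf uA uB r₀) (j * p)
        push_cast at e1 ⊢
        rw [e1]; ring
      rw [hlab]
    · rw [stateOf_add_natCast_of_gt uA uB r₀ _ hg, if_neg hg, hmod]
      have hlab : ((c + g.val + (liftOf uA uB r₀ + ((j * p : ℕ) : ZMod (M + 1))).val +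
            (stateOf m uA uB r₀ g.val + ((j * p : ℕ) : ZMod (M + 1))).val : ℕ) : ZMod 3) =
          ((c + g.val + (liftOf uA uB r₀).val + (stateOf m uA uB r₀ g.val).val : ℕ) : ZMod 3) +
            ((j : ℕ) : ZMod 3) * ((2 * p : ℕ) : ZMod 3) := by
        have e1 := cast3_val_add_nat hM (liftOf uA uB r₀) (j * p)
        have e2 := cast3_val_add_nat hM (stateOf m uA uB r₀ g.val) (j * p)
        push_cast at e1 e2 ⊢
        rw [e1, e2]; ring
      rw [hlab]
  -- conclude with the twisted three-charge identity
  intro hW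
  apply twistedNotAllThree F s t htne
  intro k
  have hk : ((k.val : ℕ) : ZMod 3) = k := ZMod.natCast_zmod_val k
  have := hW k.val (ZMod.val_lt k)
  unfold WinE at this
  rw [hset k.val, hk] at this
  exact this

end Fibre


end Summit.QuantumAdvantage.AdviceFreeQNC0.LocalEngine
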